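import Summits.CriticalPhenomena.PercolationContinuityZ3.Theorems.Transplant.CayleyCylinderStrictBox
import Summits.CriticalPhenomena.PercolationContinuityZ3.Theorems.Transplant.CayleySkeletonAdm
import HarnessLib

/-!
# The abstract Cayley-graph theorem with the CONNECTED-CYLINDER criterion: `CayleyNeg₂`, `CayleySign₂`

builds on p205010 (kernel theorem, internal audit signed; external expert review pending).
Lane `prim-bschramm`, seat `prim-bschramm-p4` gen 11 (PART C3 of `P4-GENERAL.md`, "thick frames").  Helper file
(`--supports stmt-CriticalPhenomena-4575 --as helper`).

`CayleySign₀` (file `CayleySkeletonNoFC`) needs `ker φ = ⟨S ∩ ker φ⟩`, `CayleySign₁` (file `CayleySkeletonAdm`) needs `ker φ` generated by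
kernel letters and corner-admissible commutator words.  Both are sufficient conditions for the ONE hypothesis the D″ node's interface
`PlanarSkeletonNeg.cyl_connected` actually asks of a Cayley graph: **the cylinder `C_1 = {‖φ‖_∞ ≤ 1}` of `Cay(Γ;S)` is connected** (then every
`C_ℓ`, `ℓ ≥ 1`, is, by column and row reduction — `CylData₂.cylG_connected_of_boxWalks`).  `CayleyNeg₂ / CayleySign₂` take exactly this
hypothesis; Φ2 at `p_c` is then a THEOREM (thick frames, file XI, radius `r = 5` from the telescoping lemma of file VIII), so
**`CayleySign₂.theta_eq_zero_of_le`: `θ_g(p) = 0` for every `p ≤ p_c` at every vertex of `Cay(Γ;S)`** holds for every group `Γ` and finite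
`S` carrying: an additive `φ : Γ → ℤ²` of unit range with unit steps in `S`, `S`-preserving automorphisms `ν, κ` with `φν = −φ`,
`φκ = diag(1,−1)φ`, and `C_1` connected — the interface's own hypotheses read on a Cayley graph (with the point group realised by
automorphisms of `(Γ,S)`), NOTHING ELSE (no kernel criterion, no central / finite-conjugacy element, no growth, no sign or parity condition).  The `{±1}` version is `CayleyNeg₂.theta_eq_zero_of_le_of_negNode₁`
(modulo N1).  For the algebraic customers: `CylBase.exists_inBox_of_mem_closure` (kernel generated by elements with walks inside `C_d` ⟹ every
kernel element has one).
-/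

noncomputable section

namespace Summit.CriticalPhenomena.PercolationContinuityZ3.Theorems.Transplant

open SimpleGraph Walk Literature.Probability.LatticeModels Literature.Probability.Percolation
open Literature.Barriers.CriticalPhenomena (countable_of_connected_of_locallyFinite)
open scoped Classical

namespace CayCyl

variable {Γ : Type} [Group Γ] {S : Finset Γ}

/-! ## §1 Kernel walks from generators; connected cylinders from kernel walks -/

/-- **Closure induction for walks inside a cylinder**: if every element of `T` lies in `ker φ` and is joined to `1` inside `‖φ‖_∞ ≤ d`,
so is every element of the subgroup generated by `T` (products: concatenate kernel translates; inverses: reverse and translate). [folklore] -/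
theorem CylBase.exists_inBox_of_mem_closure (B : CylBase Γ S) (d : ℕ) {T : Set Γ}
    (hT : ∀ t ∈ T, B.φ t = 0 ∧ ∃ w : (mulCayley (S : Set Γ)).Walk (1 : Γ) t, B.InBox d w) {k : Γ} (hk : k ∈ Subgroup.closure T) :
    B.φ k = 0 ∧ ∃ w : (mulCayley (S : Set Γ)).Walk (1 : Γ) k, B.InBox d w := by
  have h1 : B.φ 1 = 0 := B.φ_one
  have triv : ∃ w : (mulCayley (S : Set Γ)).Walk (1 : Γ) 1, B.InBox d w :=
    ⟨Walk.nil, fun z hz => by simp at hz; subst hz; rw [h1]; exact zero_mem_box 2 _⟩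
  have tr : ∀ {x u v : Γ}, B.φ x = 0 → ∀ {w : (mulCayley (S : Set Γ)).Walk u v}, B.InBox d w → B.InBox d (lmul S x w) := by
    intro x u v hx w hw z hz
    obtain ⟨z', hz', rfl⟩ := mem_support_lmul.1 hz
    rw [B.map_mul, hx, zero_add]; exact hw z' hz'
  induction hk using Subgroup.closure_induction with
  | mem x hx => exact hT x hx
  | one => exact ⟨h1, triv⟩
  | mul x y _ _ hx hy =>
      obtain ⟨hx0, wx, hwx⟩ := hx
      obtain ⟨hy0, wy, hwy⟩ := hy
      refine ⟨by rw [B.map_mul, hx0, hy0, add_zero], wx.append ((lmul S x wy).copy (mul_one x) rfl), fun z hz => ?_⟩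
      rw [support_append, List.mem_append] at hz
      rcases hz with hz | hz
      · exact hwx z hz
      · have hz' : z ∈ (lmul S x wy).support := by rw [support_copy] at hz; exact List.tail_subset _ hz
        exact tr hx0 hwy z hz'
  | inv x _ hx =>
      obtain ⟨hx0, wx, hwx⟩ := hx
      have hx0' : B.φ x⁻¹ = 0 := by rw [B.φ_inv, hx0, neg_zero]
      refine ⟨hx0', (lmul S x⁻¹ wx.reverse).copy (inv_mul_cancel x) (mul_one x⁻¹), fun z hz => ?_⟩
      rw [support_copy] at hz
      exact tr hx0' (fun z hz => hwx z ((mem_support_reverse_iff wx z).1 hz)) z hz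

/-- A walk of an induced subgraph of `Cay(Γ;S)` is a walk of `Cay(Γ;S)` inside the inducing set. [folklore] -/
theorem exists_walk_of_induceWalk {s : Set Γ} {u v : s} (w : ((mulCayley (S : Set Γ)).induce s).Walk u v) :
    ∃ w' : (mulCayley (S : Set Γ)).Walk u.1 v.1, ∀ z ∈ w'.support, z ∈ s := by
  induction w with
  | nil => exact ⟨Walk.nil, fun z hz => by rw [support_nil, List.mem_singleton] at hz; rw [hz]; exact Subtype.prop _⟩
  | @cons a b c h p ih =>
    obtain ⟨w', hw'⟩ := ih
    refine ⟨Walk.cons h w', fun z hz => ?_⟩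
    rw [support_cons, List.mem_cons] at hz
    rcases hz with rfl | hz
    · exact a.2
    · exact hw' z hz

namespace CylData₂

variable (E : CylData₂ Γ S)

/-- A power walk whose vertices stay in a cylinder gives reachability in the cylinder graph. [folklore] -/
theorem reachable_of_powWalkE (ℓ : ℕ) {t : Γ} (hadj : ∀ g : Γ, (mulCayley (S : Set Γ)).Adj g (g * t)) (v : E.enl.V ℓ) (n : ℕ)
    (hmem : ∀ z ∈ (powWalk S hadj v.1 n).support, z ∈ E.enl.V ℓ) :
    (E.cylG ℓ).Reachable v ⟨v.1 * t ^ n, hmem _ (Walk.end_mem_support _)⟩ :=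
  ⟨(powWalk S hadj v.1 n).induce _ hmem⟩

/-- Reduce the `0`-coordinate to `0` inside a cylinder (walk along the `s₀`-column). [folklore] -/
theorem reach_colE (ℓ : ℕ) (v : E.enl.V ℓ) :
    ∃ g : Γ, ∃ hg : g ∈ E.enl.V ℓ, E.φ g 0 = 0 ∧ E.φ g 1 = E.φ v.1 1 ∧ (E.cylG ℓ).Reachable v ⟨g, hg⟩ := by
  have hv := E.enl.memV.1 v.2; rw [abs_le, abs_le, enl_φ] at hv
  by_cases h0 : 0 ≤ E.φ v.1 0
  · obtain ⟨n, hn⟩ : ∃ n : ℕ, (n : ℤ) = E.φ v.1 0 := ⟨(E.φ v.1 0).toNat, Int.toNat_of_nonneg h0⟩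
    have hc : ∀ i : ℕ, E.φ (v.1 * E.enl.s₀⁻¹ ^ i) 0 = E.φ v.1 0 - i ∧ E.φ (v.1 * E.enl.s₀⁻¹ ^ i) 1 = E.φ v.1 1 :=
      fun i => by simpa only [enl_φ] using E.enl.φ_s₀inv_pow v.1 i
    have hmem : ∀ z ∈ (powWalk S E.adjE_s₀_inv v.1 n).support, z ∈ E.enl.V ℓ := by
      intro z hz
      obtain ⟨i, hi, rfl⟩ := (mem_support_powWalk _).1 hz
      have hi' : (i : ℤ) ≤ n := by exact_mod_cast hi
      rw [E.enl.memV, enl_φ, (hc i).1, (hc i).2, abs_le, abs_le]; omega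
    exact ⟨_, hmem _ (Walk.end_mem_support _), by rw [(hc n).1]; omega, (hc n).2, E.reachable_of_powWalkE ℓ _ v n hmem⟩
  · obtain ⟨n, hn⟩ : ∃ n : ℕ, (n : ℤ) = -E.φ v.1 0 := ⟨(-E.φ v.1 0).toNat, Int.toNat_of_nonneg (by omega)⟩
    have hc : ∀ i : ℕ, E.φ (v.1 * E.enl.s₀ ^ i) 0 = E.φ v.1 0 + i ∧ E.φ (v.1 * E.enl.s₀ ^ i) 1 = E.φ v.1 1 :=
      fun i => by simpa only [enl_φ] using E.enl.φ_s₀_pow v.1 i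
    have hmem : ∀ z ∈ (powWalk S E.adjE_s₀ v.1 n).support, z ∈ E.enl.V ℓ := by
      intro z hz
      obtain ⟨i, hi, rfl⟩ := (mem_support_powWalk _).1 hz
      have hi' : (i : ℤ) ≤ n := by exact_mod_cast hi
      rw [E.enl.memV, enl_φ, (hc i).1, (hc i).2, abs_le, abs_le]; omega
    exact ⟨_, hmem _ (Walk.end_mem_support _), by rw [(hc n).1]; omega, (hc n).2, E.reachable_of_powWalkE ℓ _ v n hmem⟩

/-- Reduce the `1`-coordinate to `0` inside a cylinder, keeping the `0`-coordinate (walk along the `s₁`-row). [folklore] -/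
theorem reach_rowE (ℓ : ℕ) (v : E.enl.V ℓ) (h0 : E.φ v.1 0 = 0) :
    ∃ k : Γ, ∃ hk : k ∈ E.enl.V ℓ, E.φ k = 0 ∧ (E.cylG ℓ).Reachable v ⟨k, hk⟩ := by
  have hv := E.enl.memV.1 v.2; rw [abs_le, abs_le, enl_φ] at hv
  have zero_of : ∀ g : Γ, E.φ g 0 = 0 → E.φ g 1 = 0 → E.φ g = 0 := fun g ha hb => by
    funext j; fin_cases j <;> assumption
  by_cases hs : 0 ≤ E.φ v.1 1
  · obtain ⟨n, hn⟩ : ∃ n : ℕ, (n : ℤ) = E.φ v.1 1 := ⟨(E.φ v.1 1).toNat, Int.toNat_of_nonneg hs⟩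
    have hc : ∀ i : ℕ, E.φ (v.1 * E.enl.s₁⁻¹ ^ i) 0 = E.φ v.1 0 ∧ E.φ (v.1 * E.enl.s₁⁻¹ ^ i) 1 = E.φ v.1 1 - i :=
      fun i => by simpa only [enl_φ] using E.enl.φ_s₁inv_pow v.1 i
    have hmem : ∀ z ∈ (powWalk S E.adjE_s₁_inv v.1 n).support, z ∈ E.enl.V ℓ := by
      intro z hz
      obtain ⟨i, hi, rfl⟩ := (mem_support_powWalk _).1 hz
      have hi' : (i : ℤ) ≤ n := by exact_mod_cast hi
      rw [E.enl.memV, enl_φ, (hc i).1, (hc i).2, abs_le, abs_le]; omega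
    exact ⟨_, hmem _ (Walk.end_mem_support _), zero_of _ (by rw [(hc n).1, h0]) (by rw [(hc n).2]; omega),
      E.reachable_of_powWalkE ℓ _ v n hmem⟩
  · obtain ⟨n, hn⟩ : ∃ n : ℕ, (n : ℤ) = -E.φ v.1 1 := ⟨(-E.φ v.1 1).toNat, Int.toNat_of_nonneg (by omega)⟩
    have hc : ∀ i : ℕ, E.φ (v.1 * E.enl.s₁ ^ i) 0 = E.φ v.1 0 ∧ E.φ (v.1 * E.enl.s₁ ^ i) 1 = E.φ v.1 1 + i :=
      fun i => by simpa only [enl_φ] using E.enl.φ_s₁_pow v.1 i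
    have hmem : ∀ z ∈ (powWalk S E.adjE_s₁ v.1 n).support, z ∈ E.enl.V ℓ := by
      intro z hz
      obtain ⟨i, hi, rfl⟩ := (mem_support_powWalk _).1 hz
      have hi' : (i : ℤ) ≤ n := by exact_mod_cast hi
      rw [E.enl.memV, enl_φ, (hc i).1, (hc i).2, abs_le, abs_le]; omega
    exact ⟨_, hmem _ (Walk.end_mem_support _), zero_of _ (by rw [(hc n).1, h0]) (by rw [(hc n).2]; omega),
      E.reachable_of_powWalkE ℓ _ v n hmem⟩

/-- **Connected cylinders from kernel walks**: if every kernel element is joined to `1` inside `C_d`, then every `C_ℓ`, `ℓ ≥ d`, is connected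
(reduce both coordinates to `0`, then use the kernel walk, which stays in `C_d ⊆ C_ℓ`). [folklore] -/
theorem cylG_connected_of_boxWalks {d : ℕ} (h : ∀ k : Γ, E.φ k = 0 → ∃ w : (mulCayley (S : Set Γ)).Walk (1 : Γ) k, E.InBox d w) {ℓ : ℕ}
    (hℓ : d ≤ ℓ) : (E.cylG ℓ).Connected := by
  have key : ∀ v : E.enl.V ℓ, (E.cylG ℓ).Reachable v ⟨1, E.one_mem_VE ℓ⟩ := by
    intro v
    obtain ⟨g, hg, hg0, -, hr⟩ := E.reach_colE ℓ v
    obtain ⟨k, hk, hk0, hr'⟩ := E.reach_rowE ℓ ⟨g, hg⟩ hg0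
    obtain ⟨w, hw⟩ := h k hk0
    have hmem : ∀ z ∈ w.support, z ∈ E.enl.V ℓ := fun z hz => by
      have hz' := hw z hz
      exact box_mono 2 hℓ hz'
    have hr'' : (E.cylG ℓ).Reachable ⟨k, hk⟩ ⟨1, E.one_mem_VE ℓ⟩ := Reachable.symm ⟨w.induce _ hmem⟩
    exact (hr.trans hr').trans hr''
  haveI : Nonempty (E.enl.V ℓ) := ⟨⟨1, E.one_mem_VE ℓ⟩⟩
  exact ⟨fun u v => (key u).trans (key v).symm⟩

/-- **All cylinders of width `≥ r` of a `CylData₂` are connected** (converse of `CylBase.toCylData₂`: "kernel generated by short elements" ⟺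
"some cylinder connected"). [folklore] -/
theorem cylG_connected_of_le {ℓ : ℕ} (hℓ : E.r ≤ ℓ) : (E.cylG ℓ).Connected :=
  E.cylG_connected_of_boxWalks E.exists_boxWalk hℓ

end CylData₂

end CayCyl

/-! ## §2 `CayleyNeg₂`: the `{±1}` datum with the connected-cylinder criterion -/

/-- **INPUT, `{±1}` version, connected-cylinder criterion**: additive `φ : Γ → ℤ²` of unit range on `S` with unit steps in `S`, an
`S`-preserving automorphism `ν` with `φν = −φ`, and the cylinder `C_1 = {‖φ‖_∞ ≤ 1}` of `Cay(Γ;S)` connected (the interface's own (κ) at `ℓ = 1`).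
[cite: KozmaNitzan2024, §4 p. 16 (Lemma 8)] [cite: BenjaminiSchramm1996, §2; Conj. 4] -/
structure CayleyNeg₂ (Γ : Type) [Group Γ] (S : Finset Γ) where
  /-- the skeleton homomorphism `φ : Γ → ℤ²` -/
  φ : Γ → Site 2
  /-- additivity -/
  map_mul : ∀ g h : Γ, φ (g * h) = φ g + φ h
  /-- generators have sup-norm `≤ 1` -/
  lip : ∀ s ∈ S, ∀ i : Fin 2, |φ s i| ≤ 1
  /-- unit steps: some generator maps to each basis vector -/
  step : ∀ i : Fin 2, ∃ s ∈ S, φ s = Pi.single i 1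
  /-- the reversing automorphism -/
  ν : Γ ≃* Γ
  /-- `ν` preserves the generating system -/
  ν_mem : ∀ s, ν s ∈ S ↔ s ∈ S
  /-- `φ ∘ ν = −φ` -/
  ν_φ : ∀ g, φ (ν g) = -φ g
  /-- the cylinder `‖φ‖_∞ ≤ 1` of `Cay(Γ;S)` is connected -/
  cyl_one : ((mulCayley (S : Set Γ)).induce {g | φ g ∈ box 2 1}).Connected

namespace CayleyNeg₂

variable {Γ : Type} [Group Γ] {S : Finset Γ} (C : CayleyNeg₂ Γ S)

/-- The base datum of a `CayleyNeg₂`. [folklore] -/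
def base : CayCyl.CylBase Γ S where
  φ := C.φ
  map_mul := C.map_mul
  lip := C.lip
  s₀ := Classical.choose (C.step 0)
  s₀_mem := (Classical.choose_spec (C.step 0)).1
  φ_s₀ := (Classical.choose_spec (C.step 0)).2
  s₁ := Classical.choose (C.step 1)
  s₁_mem := (Classical.choose_spec (C.step 1)).1
  φ_s₁ := (Classical.choose_spec (C.step 1)).2

/-- `base.φ = φ`. [folklore] -/
@[simp] theorem base_φ : C.base.φ = C.φ := rfl

/-- **Every kernel element is joined to `1` inside `C_1`** (from the connectivity of `C_1`). [folklore] -/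
theorem exists_boxWalk_one (k : Γ) (hk : C.φ k = 0) : ∃ w : (mulCayley (S : Set Γ)).Walk (1 : Γ) k, C.base.InBox 1 w := by
  have h1 : (1 : Γ) ∈ {g | C.φ g ∈ box 2 1} := by
    show C.φ 1 ∈ box 2 1; rw [show C.φ 1 = 0 from C.base.φ_one]; exact zero_mem_box 2 1
  have hk' : k ∈ {g | C.φ g ∈ box 2 1} := by show C.φ k ∈ box 2 1; rw [hk]; exact zero_mem_box 2 1
  obtain ⟨w⟩ := C.cyl_one.preconnected ⟨1, h1⟩ ⟨k, hk'⟩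
  obtain ⟨w', hw'⟩ := CayCyl.exists_walk_of_induceWalk w
  exact ⟨w', fun z hz => hw' z hz⟩

/-- **The thick cylinder datum of a `CayleyNeg₂`** (radius `5`, by the telescoping lemma of file VIII). [folklore] -/
def cylData₂ : CayCyl.CylData₂ Γ S := C.base.toCylData₂ 1 C.exists_boxWalk_one

/-- `cylData₂.φ = φ`. [folklore] -/
@[simp] theorem cylData₂_φ : C.cylData₂.φ = C.φ := rfl

/-- `φ 1 = 0`. [folklore] -/
theorem φ_one : C.φ 1 = 0 := C.base.φ_one

/-- **The cylinders `C_ℓ`, `ℓ ≥ 1`, of a `CayleyNeg₂` are connected.** [folklore] -/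
theorem cylG_connected {ℓ : ℕ} (hℓ : 1 ≤ ℓ) : (C.cylData₂.cylG ℓ).Connected :=
  C.cylData₂.cylG_connected_of_boxWalks C.exists_boxWalk_one hℓ

/-- **THE SKELETON OF A `CayleyNeg₂`**: one type (the identity), left multiplications as frames, `ν` as the central inversion, degree
bound `2|S|`, unit steps, cylinders connected for `ℓ ≥ 1`. [cite: KozmaNitzan2024, §4 p. 16 (Lemma 8)] [cite: BenjaminiSchramm1996, §2] -/
def skeleton : PlanarSkeletonNeg (mulCayley (S : Set Γ)) where
  φ := C.φ
  lip := fun _ _ h i => by rw [abs_sub_comm]; exact C.base.lip_adj h i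
  types := {1}
  frame := fun v => ⟨1, Finset.mem_singleton_self 1, leftMulIso S v, mul_one v, fun w => by
    show C.φ (v * w) = C.φ w + (C.φ v - C.φ 1)
    rw [C.map_mul, φ_one, sub_zero, add_comm]⟩
  neg := fun t ht => by
    rw [Finset.mem_singleton] at ht
    subst ht
    refine ⟨autOfMulEquiv S C.ν C.ν_mem, map_one C.ν, fun w => ?_⟩
    show C.φ (C.ν w) - C.φ 1 = -(C.φ w - C.φ 1)
    rw [φ_one, sub_zero, sub_zero, C.ν_φ]
  Δ := 2 * S.card
  degree_le := degree_mulCayley_le S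
  step := fun v i σ => by
    obtain ⟨s, hs, hφ⟩ := C.step i
    have hs1 : s ≠ 1 := by
      intro h
      have h0 := congrFun hφ i
      rw [h, φ_one] at h0
      simp at h0
    rcases Int.units_eq_one_or σ with rfl | rfl
    · exact ⟨v * s, CayCyl.adj_mul_of_mem S (Or.inl hs) hs1 v, by rw [C.map_mul, hφ, Units.val_one]⟩
    · refine ⟨v * s⁻¹, CayCyl.adj_mul_of_mem S (Or.inr (by rw [inv_inv]; exact hs)) (inv_ne_one.2 hs1) v, ?_⟩
      rw [C.map_mul, show C.φ s⁻¹ = -C.φ s from C.base.φ_inv s, hφ, Units.val_neg, Units.val_one, Pi.single_neg]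
  cyl_connected := fun t ht ℓ hℓ => by
    rw [Finset.mem_singleton] at ht
    subst ht
    have e : {w | C.φ w - C.φ 1 ∈ box 2 ℓ} = C.cylData₂.enl.V ℓ := by
      ext w; simp [CayCyl.CylData.V, cylData₂, base, CayCyl.CylData₂.enl, CayCyl.CylBase.toCylData₂, φ_one]
    rw [e]
    exact C.cylG_connected hℓ

/-- **Φ2 AT AND BELOW `p_c` FOR EVERY `CayleyNeg₂`**: for `p ≤ p_c(Cay(Γ;S))` no cylinder of the skeleton percolates at `p` (file XI:
`p_c ≤ p_c(C_{ℓ+11}) < p_c(C_ℓ)` or `p_c(C_ℓ) = 1`). [cite: AizenmanGrimmett1991, Thm 1 (essential enhancements)] [cite: Menshikov1987, Thm (graph and subgraph)] -/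
theorem cylSubcritical_of_le {p : unitInterval} (hp : (p : ℝ) ≤ criticalProb (mulCayley (S : Set Γ)) (1 : Γ)) :
    C.skeleton.CylSubcritical p := by
  intro t ht ℓ
  change t ∈ ({1} : Finset Γ) at ht
  rw [Finset.mem_singleton] at ht
  subst ht
  haveI : Countable Γ := countable_of_connected_of_locallyFinite _ (C.skeleton.graph_connected (1 : Γ)) 1
  have e : {w | C.skeleton.φ w - C.skeleton.φ 1 ∈ box 2 ℓ} = C.cylData₂.enl.V ℓ := by
    ext w; simp [CayCyl.CylData.V, cylData₂, base, CayCyl.CylData₂.enl, CayCyl.CylBase.toCylData₂, skeleton, φ_one]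
  show theta ((mulCayley (S : Set Γ)).induce {w | C.skeleton.φ w - C.skeleton.φ 1 ∈ box 2 ℓ}) ⟨1, _⟩ _ = 0
  rw [theta_induce_congr _ e]
  have h0 := C.cylData₂.theta_cyl_criticalProb_eq_zeroE (C.skeleton.criticalProb_lt_one 1) ℓ
  have hmono : theta (C.cylData₂.cylG ℓ) ⟨1, C.cylData₂.one_mem_VE ℓ⟩ p ≤
      theta (C.cylData₂.cylG ℓ) ⟨1, C.cylData₂.one_mem_VE ℓ⟩ (criticalProbIOf (mulCayley (S : Set Γ)) (1 : Γ)) :=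
    theta_mono_holds _ _ (Subtype.coe_le_coe.mp hp)
  have hnn : 0 ≤ theta (C.cylData₂.cylG ℓ) ⟨1, C.cylData₂.one_mem_VE ℓ⟩ p := MeasureTheory.measureReal_nonneg
  linarith

include C in
/-- **CONDITIONAL THEOREM: `θ_g(p) = 0` on `Cay(Γ; S)` for every `p ≤ p_c` and every `CayleyNeg₂`, modulo `SamePDropOfSkeletonNeg₁`**
(connected-cylinder criterion; Φ2 derived). [cite: BenjaminiSchramm1996, Conj. 4; §2] -/
theorem theta_eq_zero_of_le_of_negNode₁ {p : unitInterval} (hN : SamePDropOfSkeletonNeg₁) (g : Γ)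
    (hp : (p : ℝ) ≤ criticalProb (mulCayley (↑S : Set Γ)) g) : theta (mulCayley (↑S : Set Γ)) g p = 0 := by
  haveI : Countable Γ := countable_of_connected_of_locallyFinite _ (C.skeleton.graph_connected g) g
  have hbase : theta (mulCayley (S : Set Γ)) (1 : Γ) (criticalProbIOf (mulCayley (S : Set Γ)) 1) = 0 :=
    continuity_of_negNode₁ hN _ C.skeleton (Finset.mem_singleton_self 1) rfl (C.cylSubcritical_of_le le_rfl)
  have hθ := theta_iso (leftMulIso S g) (1 : Γ) (criticalProbIOf (mulCayley (S : Set Γ)) 1)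
  have hpc := criticalProb_iso (leftMulIso S g) (1 : Γ)
  rw [leftMulIso_apply, mul_one] at hθ hpc
  have e : criticalProbIOf (mulCayley (S : Set Γ)) g = criticalProbIOf (mulCayley (S : Set Γ)) 1 := Subtype.ext hpc
  have hpc0 : theta (mulCayley (S : Set Γ)) g (criticalProbIOf (mulCayley (S : Set Γ)) g) = 0 := by rw [e, hθ]; exact hbase
  have hmono : theta (mulCayley (S : Set Γ)) g p ≤ theta (mulCayley (S : Set Γ)) g (criticalProbIOf (mulCayley (S : Set Γ)) g) :=
    theta_mono_holds _ _ (Subtype.coe_le_coe.mp hp)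
  have hnn : 0 ≤ theta (mulCayley (S : Set Γ)) g p := MeasureTheory.measureReal_nonneg
  linarith

end CayleyNeg₂

/-! ## §3 `CayleySign₂` and the unconditional theorem -/

/-- **INPUT, `(ℤ/2)²` version, connected-cylinder criterion**: a `CayleyNeg₂` plus a second `S`-preserving automorphism `κ` with
`φκ = (φ₀, −φ₁)`. [cite: KozmaNitzan2024, §4 p. 16 (Lemma 8)] [cite: BenjaminiSchramm1996, §2; Conj. 4] -/
structure CayleySign₂ (Γ : Type) [Group Γ] (S : Finset Γ) extends CayleyNeg₂ Γ S where
  /-- the axis flip -/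
  κ : Γ ≃* Γ
  /-- `κ` preserves the generating system -/
  κ_mem : ∀ s, κ s ∈ S ↔ s ∈ S
  /-- `φ ∘ κ = flipSnd ∘ φ` -/
  κ_φ : ∀ g, φ (κ g) = flipSnd (φ g)

namespace CayleySign₂

variable {Γ : Type} [Group Γ] {S : Finset Γ} (C : CayleySign₂ Γ S)

/-- **THE SIGN SKELETON OF A `CayleySign₂`.** [cite: KozmaNitzan2024, §4 p. 16 (Lemma 8)] -/
def skeletonSign : PlanarSkeletonSign (mulCayley (S : Set Γ)) where
  toPlanarSkeletonNeg := C.toCayleyNeg₂.skeleton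
  flip := fun t ht => by
    change t ∈ ({1} : Finset Γ) at ht
    rw [Finset.mem_singleton] at ht
    subst ht
    refine ⟨autOfMulEquiv S C.κ C.κ_mem, map_one C.κ, fun w => ?_⟩
    show C.φ (C.κ w) - C.φ 1 = flipSnd (C.φ w - C.φ 1)
    rw [C.toCayleyNeg₂.φ_one, sub_zero, sub_zero, C.κ_φ]

include C in
/-- **THEOREM (unconditional, connected-cylinder criterion): `θ_g(p) = 0` for every `p ≤ p_c`, at every vertex of `Cay(Γ; S)`, for every
group `Γ` and finite `S` carrying a `CayleySign₂`** — an additive planar skeleton of unit range with unit steps, `S`-preserving automorphisms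
acting by `−I` and `diag(1,−1)` on it, and the cylinder `‖φ‖_∞ ≤ 1` connected: the hypotheses of the D″ interface `PlanarSkeletonSign`
read on a Cayley graph (one type; the point group realised by automorphisms of `(Γ, S)`) — Φ2 at `p_c` is DERIVED (thick frames), no kernel
criterion, no central element, no growth hypothesis.
(`p = p_c`: continuity of the phase transition; `p < p_c`: definition of `p_c`.)
builds on p205010 (kernel theorem, internal audit signed; external expert review pending).
[cite: BenjaminiSchramm1996, Conj. 4; §2] [cite: AizenmanGrimmett1991, Thm 1] [cite: KozmaNitzan2024, §1 p. 2 (approach 1)] -/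
theorem theta_eq_zero_of_le {p : unitInterval} (g : Γ) (hp : (p : ℝ) ≤ criticalProb (mulCayley (↑S : Set Γ)) g) :
    theta (mulCayley (↑S : Set Γ)) g p = 0 := by
  have hpc0 : theta (mulCayley (S : Set Γ)) g (criticalProbIOf (mulCayley (S : Set Γ)) g) = 0 :=
    PlanarSkeletonSign.criticalContinuity' _ C.skeletonSign
      (fun t ht => by
        have ht' : t = 1 := by
          change t ∈ ({1} : Finset Γ) at ht
          exact Finset.mem_singleton.1 ht
        subst ht'
        exact C.toCayleyNeg₂.cylSubcritical_of_le le_rfl) g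
  haveI : Countable Γ := countable_of_connected_of_locallyFinite _ (C.toCayleyNeg₂.skeleton.graph_connected g) g
  have hmono : theta (mulCayley (S : Set Γ)) g p ≤ theta (mulCayley (S : Set Γ)) g (criticalProbIOf (mulCayley (S : Set Γ)) g) :=
    theta_mono_holds _ _ (Subtype.coe_le_coe.mp hp)
  have hnn : 0 ≤ theta (mulCayley (S : Set Γ)) g p := MeasureTheory.measureReal_nonneg
  linarith

include C in
/-- **`θ_g(p_c) = 0` at every vertex of `Cay(Γ;S)` for every `CayleySign₂`** (the `p = p_c` case of `theta_eq_zero_of_le`).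
builds on p205010 (kernel theorem, internal audit signed; external expert review pending). [cite: BenjaminiSchramm1996, Conj. 4] -/
theorem criticalContinuity₂ : ∀ g : Γ, theta (mulCayley (↑S : Set Γ)) g (criticalProbIOf (mulCayley (↑S : Set Γ)) g) = 0 :=
  fun g => C.theta_eq_zero_of_le g le_rfl

end CayleySign₂

end Summit.CriticalPhenomena.PercolationContinuityZ3.Theorems.Transplant

end
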